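import Summits.BirchSwinnertonDyer.BirchSwinnertonDyer.Theorems.ThetaPartnerAtTwoSignedMainConjectureCMTwoRankZeroKatoUpTo
import Summits.BirchSwinnertonDyer.BirchSwinnertonDyer.Theorems.ByReductionTypeAtTwoSupersingularThetaHabitat
import HarnessLib

/-!
# Crux `SupersingularRankZeroAtTwo` (item stmt-BirchSwinnertonDyer-19097, route `ByReductionTypeAtTwo`, rung K4) ON THE
# THETA HABITAT with NO EISENSTEIN-SIDE INPUT ON EITHER CURVE: Kato's zeta elements on both sides of `E[2] ≅ A[2]`,
# Burungale–Flach's BSD₂(A) in the Eisenstein role, TP2's transport K1 by name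
# (seat `bsd-2adic-ss-1x` GEN 3, WIDTH-LEVER second prover lane on 19097; theta / CM-partner road)

HONEST FRAMING (cells `bsd-2adic` run/shared/lean/pub/bsd-2adic/ and `bsd-wall` …/bsd-wall/; HUMAN RULINGS
D-0036/D-0054/D-0074): THEOREMS ONLY — no definition, no named fact, no instance, no `sorry`; nothing about any
Selmer group, zeta element or `L`-value is asserted beyond the displayed binders; closes no item; BSD is NOT proved
by any of this. PARTITION (D-0054): X5@2 good-supersingular, `a₂ = 0` THETA-HABITAT sub-row (19/208 rank-`0`
census classes, HABITAT-CENSUS-TP2-v1) × `p = 2` — types-the-object-of; bears_on: K4-leaf crux 19097 · TP2 items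
K1 20333 (by name), K2r0 20312 / K3 20308 / K4 20309 (produced from displayed stubs, not assumed).

WHAT. The slice leaf `Summit.BirchSwinnertonDyer.WAllNonCMAtTwoThetaHabitat` (= crux 19097 restricted to the theta
habitat; `ThetaPartnerXRoute.thetaHabitat_of_supersingularRankZeroAtTwo` / `…_of_thetaHabitat_of_offHabitat`,
p528677, give the exact logical position) from:
* for `E` (non-CM, `r_an = 0`, good supersingular at `2`, `a₂ = 0`): 19097's registered stubs (1) `stub_ssPub`,
  (1′) `stub_katoPub`, (2′) `stub_zeroSignedEulerChar` VERBATIM, and (4) `stub_zeroColemanKato` with its guarded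
  `TwoAdicSurjective W → …` clause DELETED (the RATIONAL Coleman–Kato package);
* for the rank-`0` CM partners `A`: (T2_A) torsion of `X⁺(A/ℚ_∞)`, (μ_A) `μ⁺(A) = 0`, (K4c_A) Kim's control term at
  `2`, and (4)ʳᵃᵗ READ AT `A` (the same rational Coleman–Kato package; Kato §15 covers CM newforms);
* TP2's K1 `SignedTransportAtTwo` BY NAME; PUB by name: Burungale–Flach `hBF`, the `p = 2` period fact `h2`.
ABSENT: 19097's stub (3) `KobayashiLowerDivisibility W 2 1` (the HARDEST stub of line `signed_halves_two` v9), K2r0's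
stub (E_A) `KobayashiLowerDivisibility A 2 1` (Pollack–Rubin / elliptic units at the inert prime `2`; tp2-p2 g3:
open-problem with a `μ₆`-obstruction), stub (4′), every `TwoAdicSurjective` guard, the analytic `μ(L♭_A) = 0`.
Compared with `ThetaPartnerXRoute.thetaHabitat_of_signedTransport_of_stubs` (p528677: binders (1)(1′)(2′)(4) + K1 +
K2r0 BY NAME) the K2r0 item is UNFOLDED into inputs of the same species as `E`'s, the Eisenstein half dropping out:
on the habitat BSD₂ needs Kato-side divisibilities only, Burungale–Flach's theorem BSD₂(A) standing in for the
Eisenstein side of BOTH curves. What remains research-grade at `2` (numbers, not adjectives): K1 (transport: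
tp2-p1's three stubs), (2′) for `E` and for `A` (Kobayashi 1.2 / Kim 3.15 at `2`), the rational Coleman–Kato
package for `E` and for `A` (Kobayashi §8 Coleman map at `2` + Kato 12.5 (3), PRINT for the Kato part), and ONE
`μ`-clause `μ⁺(A) = 0` (⟺ `μ⁺(E) = 0` along `E[2] ≅ A[2]`, B. D. Kim 2009 Cor. 2.13 shape).

References: [Kobayashi2003] Thm. 1.2, Thm. 4.1 (p. 8), §7, Conjecture (p. 2); [Kato2004Asterisque] Thm. 12.4–12.5
(pp. 221–222), §15 (15.18); [BDKim2013] Cor. 3.15; [BDKim2009] Cor. 2.13; [BurungaleFlach2024] Thm. 1.1 / Cor. 2;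
[GreenbergVatsal2000] Thm. (1.4), §3 Rem. 3.4; [AbbesUllmo1996] Thm. A; [PollackRubin2004] Thm. 7.3 (NOT used);
[KuriharaOtsuki2006] pp. 557, 564; [Miller2011LMS] Def. 1.1; memo run/shared/lean/pub/bsd-wall/bsd-wall-p2/xroute/CROSS-ROUTE-TP2-K3K4-v1.md.
-/

set_option autoImplicit false
-- the Theorems namespace of this sub repeats the summit name by design (D-0017 nested layout)
set_option linter.dupNamespace false

noncomputable section

open scoped Classical MatrixGroups ModularForm

open CongruenceSubgroup WeierstrassCurve Literature.NumberTheory.EllipticCurves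
  Literature.NumberTheory.EllipticCurves.ModularForms Literature.NumberTheory.EllipticCurves.Sprung2017
  Literature.NumberTheory.EllipticCurves.Rank1Residual Literature.NumberTheory.EllipticCurves.Rank1Residual.Typed
  Literature.NumberTheory.EllipticCurves.Kobayashi2003 Literature.NumberTheory.EllipticCurves.IwasawaDual
  ZpExtension Summit.BirchSwinnertonDyer.Rank1Residual Summit.BirchSwinnertonDyer.Rank1Residual.Supersingular
  Summit.BirchSwinnertonDyer.Rank1Residual.X5.O1 Summit.BirchSwinnertonDyer.BirchSwinnertonDyer.Theses.ThetaPartnerAtTwo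

namespace Summit.BirchSwinnertonDyer.BirchSwinnertonDyer.Theorems

namespace ThetaPartnerXRoute

/-! ## §1 The Kato half UP TO `2^m` at ONE curve from Kato PUB + the rational Coleman–Kato package there -/

/-- **K3's shape at one curve `W` (CM or not) from Kato PUB and the RATIONAL Coleman–Kato package at `W`.** Per
datum, H3 `exists_charGenerator_mul_eq_C_pow_mul_of_colemanSkeletonRat` (p527438; any curve, any prime): `𝐇¹`
torsion free of rank `≤ 1` is Kato 12.4 (2) (`h124`), `X⁰` torsion is 12.4 (1) ∘ (17.13.1) (`hX0`) — both PRINT for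
every newform incl. CM ones (Kato §15, 15.18) — and the continuity of the Galois action on `T₂W` is the tree theorem
`TateModule.continuousSMul_padicInt`. The package `hCK` is 19097's stub (4) body AT `W` with the guarded `𝔭 ∋ 2`
clause deleted. [cite: Kato2004Asterisque, Thm. 12.4 (1)(2), Thm. 12.5 (3) (pp. 221–222), §15 (15.18)]
[cite: Kobayashi2003, Thm. 4.1 first display (p. 8) and Thm. 7.3 (p. 13)] -/
theorem katoUpTo_at_of_colemanKatoRat_at (h124 : Kato2004.thm12_4) (hX0 : Kato2004_fineSelmerDual_isTorsion)
    (W : WeierstrassCurve ℚ) [W.IsElliptic] [W.IsGloballyMinimal]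
    (hCK : ∀ (κ : ZpExtension ℚ 2) (γ : Field.absoluteGaloisGroup ℚ),
        κ.IsCyclotomic → κ.IsTopGenerator γ → IsCyclotomicVariable 2 γ →
        ∀ [NeZero (W.conductorNorm ℤ)] (f : CuspForm (Gamma0 (W.conductorNorm ℤ)) 2),
          IsNewformOf W f → ∀ (ϖ : ℚ), (ϖ : ℝ) * W.realPeriodRat = plusPeriod f →
        ∀ (Lplus Lminus : IwasawaAlgebra 2), IsPollackPair f 2 Lplus Lminus →
        ∀ (D : SignedSelmerDualData W κ γ 1) [ContinuousSMul ℤ_[2] (W.tateModule 2)],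
          ∃ (I : Kato2004.IwasawaH1Data W 2 κ γ) (Y : W.FineSelmerDualData κ γ)
            (P : Submodule (IwasawaAlgebra 2) (IwasawaAlgebra 2))
            (loc : I.H →ₗ[IwasawaAlgebra 2] P) (toX : P →ₗ[IwasawaAlgebra 2] D.X)
            (δ : D.X →ₗ[IwasawaAlgebra 2] Y.X) (Z : Submodule (IwasawaAlgebra 2) I.H)
            (G : IwasawaAlgebra 2),
            Function.Exact loc toX ∧ Function.Exact toX δ ∧
            G ∈ Submodule.map (P.subtype ∘ₗ loc) Z ∧
            iwasawaToPowerSeries 2 G =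
              PowerSeries.C (ϖ : ℚ_[2]) * iwasawaToPowerSeries 2 (kobayashiL 1 Lplus Lminus) ∧
            (∀ 𝔭 : PrimeSpectrum (IwasawaAlgebra 2), 𝔭.asIdeal.height = 1 →
              PowerSeries.C (2 : ℤ_[2]) ∉ 𝔭.asIdeal →
              Literature.NumberTheory.EllipticCurves.Module.lengthAt (IwasawaAlgebra 2) Y.X 𝔭 ≤
                Literature.NumberTheory.EllipticCurves.Module.lengthAt (IwasawaAlgebra 2) (I.H ⧸ Z) 𝔭)) :
    ∀ (κ : ZpExtension ℚ 2) (γ : Field.absoluteGaloisGroup ℚ),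
        κ.IsCyclotomic → κ.IsTopGenerator γ → IsCyclotomicVariable 2 γ →
      ∀ [NeZero (W.conductorNorm ℤ)] (f : CuspForm (Gamma0 (W.conductorNorm ℤ)) 2),
        IsNewformOf W f → ∀ (ϖ : ℚ), (ϖ : ℝ) * W.realPeriodRat = plusPeriod f →
      ∀ (Lplus Lminus : IwasawaAlgebra 2), IsPollackPair f 2 Lplus Lminus →
      ∀ (D : SignedSelmerDualData W κ γ 1),
        ∃ (g h : IwasawaAlgebra 2) (m : ℕ), D.charIdeal = Ideal.span {g} ∧
          iwasawaToPowerSeries 2 (g * h) =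
            PowerSeries.C ((2 : ℚ_[2]) ^ m * (ϖ : ℚ_[2])) * iwasawaToPowerSeries 2 (kobayashiL 1 Lplus Lminus) := by
  intro κ γ hκ hγ hγ' _ f hf ϖ hϖ Lplus Lminus hPP D
  haveI : ContinuousSMul ℤ_[2] (W.tateModule 2) := TateModule.continuousSMul_padicInt
  obtain ⟨I, Y, P, loc, toX, δ, Z, G, hPX, hXY, hGZ, hιG, hES⟩ := hCK κ γ hκ hγ hγ' f hf ϖ hϖ Lplus Lminus hPP D
  have hY : Module.IsTorsion (IwasawaAlgebra 2) Y.X := hX0 W 2 κ γ hκ hγ Y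
  obtain ⟨htf, hrank⟩ := h124.isTorsionFree_and_rank_le_one W 2 hκ hγ I
  haveI := htf
  obtain ⟨g, h, m, hg, hgh⟩ := exists_charGenerator_mul_eq_C_pow_mul_of_colemanSkeletonRat hγ I hrank Y D
    loc P.subtype P.injective_subtype toX δ hPX hXY hY Z hGZ
    (fun 𝔭 h1 hp𝔭 ↦ hES 𝔭 h1 (by simpa using hp𝔭)) hιG
  refine ⟨g, h, m, hg, ?_⟩
  rw [hgh, map_mul, mul_assoc]
  norm_num

/-- **(K3_A) class-wide**: the Kato half up to `2^m` at every rank-`0` CM partner, from Kato PUB and the rational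
Coleman–Kato package READ AT the partners (`katoUpTo_at_of_colemanKatoRat_at` under the CM prefix).
[cite: Kato2004Asterisque, Thm. 12.4–12.5 (3), §15 (15.18)] [cite: Kobayashi2003, Thm. 4.1 (p. 8)] -/
theorem katoUpToCM_of_colemanKatoRatCM (h124 : Kato2004.thm12_4) (hX0 : Kato2004_fineSelmerDual_isTorsion)
    (hCKA : ∀ (A : WeierstrassCurve ℚ) [A.IsElliptic] [A.IsGloballyMinimal],
      A.HasCM → A.analyticRank = 0 → GoodSS A 2 → A.frobeniusTrace 2 = 0 →
      ∀ (κ : ZpExtension ℚ 2) (γ : Field.absoluteGaloisGroup ℚ),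
        κ.IsCyclotomic → κ.IsTopGenerator γ → IsCyclotomicVariable 2 γ →
        ∀ [NeZero (A.conductorNorm ℤ)] (f : CuspForm (Gamma0 (A.conductorNorm ℤ)) 2),
          IsNewformOf A f → ∀ (ϖ : ℚ), (ϖ : ℝ) * A.realPeriodRat = plusPeriod f →
        ∀ (Lplus Lminus : IwasawaAlgebra 2), IsPollackPair f 2 Lplus Lminus →
        ∀ (D : SignedSelmerDualData A κ γ 1) [ContinuousSMul ℤ_[2] (A.tateModule 2)],
          ∃ (I : Kato2004.IwasawaH1Data A 2 κ γ) (Y : A.FineSelmerDualData κ γ)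
            (P : Submodule (IwasawaAlgebra 2) (IwasawaAlgebra 2))
            (loc : I.H →ₗ[IwasawaAlgebra 2] P) (toX : P →ₗ[IwasawaAlgebra 2] D.X)
            (δ : D.X →ₗ[IwasawaAlgebra 2] Y.X) (Z : Submodule (IwasawaAlgebra 2) I.H)
            (G : IwasawaAlgebra 2),
            Function.Exact loc toX ∧ Function.Exact toX δ ∧
            G ∈ Submodule.map (P.subtype ∘ₗ loc) Z ∧
            iwasawaToPowerSeries 2 G =
              PowerSeries.C (ϖ : ℚ_[2]) * iwasawaToPowerSeries 2 (kobayashiL 1 Lplus Lminus) ∧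
            (∀ 𝔭 : PrimeSpectrum (IwasawaAlgebra 2), 𝔭.asIdeal.height = 1 →
              PowerSeries.C (2 : ℤ_[2]) ∉ 𝔭.asIdeal →
              Literature.NumberTheory.EllipticCurves.Module.lengthAt (IwasawaAlgebra 2) Y.X 𝔭 ≤
                Literature.NumberTheory.EllipticCurves.Module.lengthAt (IwasawaAlgebra 2) (I.H ⧸ Z) 𝔭)) :
    ∀ (A : WeierstrassCurve ℚ) [A.IsElliptic] [A.IsGloballyMinimal],
      A.HasCM → A.analyticRank = 0 → GoodSS A 2 → A.frobeniusTrace 2 = 0 →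
      ∀ (κ : ZpExtension ℚ 2) (γ : Field.absoluteGaloisGroup ℚ),
        κ.IsCyclotomic → κ.IsTopGenerator γ → IsCyclotomicVariable 2 γ →
      ∀ [NeZero (A.conductorNorm ℤ)] (f : CuspForm (Gamma0 (A.conductorNorm ℤ)) 2),
        IsNewformOf A f → ∀ (ϖ : ℚ), (ϖ : ℝ) * A.realPeriodRat = plusPeriod f →
      ∀ (Lplus Lminus : IwasawaAlgebra 2), IsPollackPair f 2 Lplus Lminus →
      ∀ (D : SignedSelmerDualData A κ γ 1),
        ∃ (g h : IwasawaAlgebra 2) (m : ℕ), D.charIdeal = Ideal.span {g} ∧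
          iwasawaToPowerSeries 2 (g * h) =
            PowerSeries.C ((2 : ℚ_[2]) ^ m * (ϖ : ℚ_[2])) * iwasawaToPowerSeries 2 (kobayashiL 1 Lplus Lminus) :=
  fun A _ _ hcm hr hss ha => katoUpTo_at_of_colemanKatoRat_at h124 hX0 A (hCKA A hcm hr hss ha)

/-! ## §2 The habitat composition (class-wide binders) -/

/-- **Crux 19097 ON THE THETA HABITAT (`WAllNonCMAtTwoThetaHabitat`) with NO EISENSTEIN-SIDE INPUT ON EITHER
CURVE.** Binders: PUB (1) `hPub` (modularity ∧ GZK), Kato PUB (1′) `hKatoPub` (Thm. 12.4 (2) ∧ 12.4 (1) ∘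
(17.13.1), any newform), Burungale–Flach `hBF`, the `p = 2` period fact `h2`; for `E` (non-CM, `r_an = 0`, good
supersingular at `2`, `a₂ = 0`): (2′) `hEC` = 19097's `stub_zeroSignedEulerChar` VERBATIM and (4)ʳᵃᵗ `hCK` =
`stub_zeroColemanKato` with its guarded `𝔭 ∋ 2` clause deleted; for the rank-`0` CM partners `A`: (T2_A) `hT2A`,
(μ_A) `hmuA`, (K4c_A) `hKimA`, (4)ʳᵃᵗ_A `hCKA`; TP2's K1 `SignedTransportAtTwo` `hT` by name. Assembly: K2r0
from `signedMainConjectureCMTwoRankZero_of_katoUpTo_of_mu` (companion file §3) + §1, K3 from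
`signedKatoDivisibilityUpToAtTwo_of_colemanKatoRatAtTwo` (p527438), K4 from
`signedControlAtTwo_of_signedEulerCharAtTwo` (p526623), then TP2's `closes` (`thetaHabitat_of_thetaPartnerItems`,
p528677). Neither `KobayashiLowerDivisibility W 2 1` (19097 stub (3)) nor `KobayashiLowerDivisibility A 2 1` (K2r0
line `rankzero` stub (E_A)) nor stub (4′) nor any `TwoAdicSurjective` guard occurs.
[cite: BurungaleFlach2024, Thm. 1.1 and Cor. 2] [cite: Kobayashi2003, Thm. 1.2, Thm. 4.1 and §7]
[cite: Kato2004Asterisque, Thm. 12.4–12.5 (3), §15] [cite: BDKim2013, Cor. 3.15] [cite: GreenbergVatsal2000, Thm. (1.4)]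
[cite: AbbesUllmo1996, Thm. A] [cite: Miller2011LMS, Def. 1.1] -/
theorem thetaHabitat_of_signedTransport_of_katoBothSides
    (hPub : nonempty_modularParametrizationData ∧ rank_eq_analyticRank_of_analyticRank_le_one)
    (hKatoPub : Kato2004.thm12_4 ∧ Kato2004_fineSelmerDual_isTorsion)
    (hBF : bsdTriple_of_hasCM_of_L_one_ne_zero) (h2 : realPeriodRat_eq_unit_mul_plusPeriod_two)
    (hEC : ∀ (W : WeierstrassCurve ℚ) [W.IsElliptic] [W.IsGloballyMinimal],
      ¬ W.HasCM → W.analyticRank = 0 → GoodSS W 2 → W.frobeniusTrace 2 = 0 →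
      ∀ (κ : ZpExtension ℚ 2) (γ : Field.absoluteGaloisGroup ℚ),
          κ.IsCyclotomic → κ.IsTopGenerator γ → Finite (W.selmerGroupPInfty 2) →
          Finite (endInvariants (conjSignedSelmerInfty W κ 1 γ - 1)) ∧
            ∃ u : ℤ_[2]ˣ, (Nat.card (endInvariants (conjSignedSelmerInfty W κ 1 γ - 1)) : ℚ_[2]) =
              ((u : ℤ_[2]) : ℚ_[2]) * ((2 : ℕ) : ℚ_[2]) ^ (padicValNat 2 W.tamagawaProduct) *
                (Nat.card (W.selmerGroupPInfty 2) : ℚ_[2]) *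
                  (Nat.card (EndCoinvariants (conjSignedSelmerInfty W κ 1 γ - 1)) : ℚ_[2]))
    (hCK : ∀ (W : WeierstrassCurve ℚ) [W.IsElliptic] [W.IsGloballyMinimal],
      ¬ W.HasCM → W.analyticRank = 0 → GoodSS W 2 → W.frobeniusTrace 2 = 0 →
      ∀ (κ : ZpExtension ℚ 2) (γ : Field.absoluteGaloisGroup ℚ),
        κ.IsCyclotomic → κ.IsTopGenerator γ → IsCyclotomicVariable 2 γ →
        ∀ [NeZero (W.conductorNorm ℤ)] (f : CuspForm (Gamma0 (W.conductorNorm ℤ)) 2),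
          IsNewformOf W f → ∀ (ϖ : ℚ), (ϖ : ℝ) * W.realPeriodRat = plusPeriod f →
        ∀ (Lplus Lminus : IwasawaAlgebra 2), IsPollackPair f 2 Lplus Lminus →
        ∀ (D : SignedSelmerDualData W κ γ 1) [ContinuousSMul ℤ_[2] (W.tateModule 2)],
          ∃ (I : Kato2004.IwasawaH1Data W 2 κ γ) (Y : W.FineSelmerDualData κ γ)
            (P : Submodule (IwasawaAlgebra 2) (IwasawaAlgebra 2))
            (loc : I.H →ₗ[IwasawaAlgebra 2] P) (toX : P →ₗ[IwasawaAlgebra 2] D.X)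
            (δ : D.X →ₗ[IwasawaAlgebra 2] Y.X) (Z : Submodule (IwasawaAlgebra 2) I.H)
            (G : IwasawaAlgebra 2),
            Function.Exact loc toX ∧ Function.Exact toX δ ∧
            G ∈ Submodule.map (P.subtype ∘ₗ loc) Z ∧
            iwasawaToPowerSeries 2 G =
              PowerSeries.C (ϖ : ℚ_[2]) * iwasawaToPowerSeries 2 (kobayashiL 1 Lplus Lminus) ∧
            (∀ 𝔭 : PrimeSpectrum (IwasawaAlgebra 2), 𝔭.asIdeal.height = 1 →
              PowerSeries.C (2 : ℤ_[2]) ∉ 𝔭.asIdeal →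
              Literature.NumberTheory.EllipticCurves.Module.lengthAt (IwasawaAlgebra 2) Y.X 𝔭 ≤
                Literature.NumberTheory.EllipticCurves.Module.lengthAt (IwasawaAlgebra 2) (I.H ⧸ Z) 𝔭))
    (hT2A : ∀ (A : WeierstrassCurve ℚ) [A.IsElliptic] [A.IsGloballyMinimal],
      A.HasCM → A.analyticRank = 0 → GoodSS A 2 → A.frobeniusTrace 2 = 0 →
      ∀ (κ : ZpExtension ℚ 2) (γ : Field.absoluteGaloisGroup ℚ), κ.IsCyclotomic → κ.IsTopGenerator γ →
      ∀ D : SignedSelmerDualData A κ γ 1, Module.IsTorsion (IwasawaAlgebra 2) D.X)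
    (hmuA : ∀ (A : WeierstrassCurve ℚ) [A.IsElliptic] [A.IsGloballyMinimal],
      A.HasCM → A.analyticRank = 0 → GoodSS A 2 → A.frobeniusTrace 2 = 0 →
      ∀ (κ : ZpExtension ℚ 2) (γ : Field.absoluteGaloisGroup ℚ), κ.IsCyclotomic → κ.IsTopGenerator γ →
      ∀ D : SignedSelmerDualData A κ γ 1, D.mu = 0)
    (hKimA : ∀ (A : WeierstrassCurve ℚ) [A.IsElliptic] [A.IsGloballyMinimal],
      A.HasCM → A.analyticRank = 0 → GoodSS A 2 → A.frobeniusTrace 2 = 0 →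
      ∀ (κ : ZpExtension ℚ 2) (γ : Field.absoluteGaloisGroup ℚ), κ.IsCyclotomic → κ.IsTopGenerator γ →
      ∀ (D : SignedSelmerDualData A κ γ 1) [Module.Finite (IwasawaAlgebra 2) D.X],
        Module.IsTorsion (IwasawaAlgebra 2) D.X →
      ∀ g : IwasawaAlgebra 2, D.charIdeal = Ideal.span {g} → Finite (A.selmerGroupPInfty 2) →
        ∃ u : ℤ_[2]ˣ, ((PowerSeries.constantCoeff g : ℤ_[2]) : ℚ_[2]) =
          ((u : ℤ_[2]) : ℚ_[2]) * ((2 : ℕ) : ℚ_[2]) ^ (padicValNat 2 A.tamagawaProduct) *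
            (Nat.card (A.selmerGroupPInfty 2) : ℚ_[2]))
    (hCKA : ∀ (A : WeierstrassCurve ℚ) [A.IsElliptic] [A.IsGloballyMinimal],
      A.HasCM → A.analyticRank = 0 → GoodSS A 2 → A.frobeniusTrace 2 = 0 →
      ∀ (κ : ZpExtension ℚ 2) (γ : Field.absoluteGaloisGroup ℚ),
        κ.IsCyclotomic → κ.IsTopGenerator γ → IsCyclotomicVariable 2 γ →
        ∀ [NeZero (A.conductorNorm ℤ)] (f : CuspForm (Gamma0 (A.conductorNorm ℤ)) 2),
          IsNewformOf A f → ∀ (ϖ : ℚ), (ϖ : ℝ) * A.realPeriodRat = plusPeriod f →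
        ∀ (Lplus Lminus : IwasawaAlgebra 2), IsPollackPair f 2 Lplus Lminus →
        ∀ (D : SignedSelmerDualData A κ γ 1) [ContinuousSMul ℤ_[2] (A.tateModule 2)],
          ∃ (I : Kato2004.IwasawaH1Data A 2 κ γ) (Y : A.FineSelmerDualData κ γ)
            (P : Submodule (IwasawaAlgebra 2) (IwasawaAlgebra 2))
            (loc : I.H →ₗ[IwasawaAlgebra 2] P) (toX : P →ₗ[IwasawaAlgebra 2] D.X)
            (δ : D.X →ₗ[IwasawaAlgebra 2] Y.X) (Z : Submodule (IwasawaAlgebra 2) I.H)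
            (G : IwasawaAlgebra 2),
            Function.Exact loc toX ∧ Function.Exact toX δ ∧
            G ∈ Submodule.map (P.subtype ∘ₗ loc) Z ∧
            iwasawaToPowerSeries 2 G =
              PowerSeries.C (ϖ : ℚ_[2]) * iwasawaToPowerSeries 2 (kobayashiL 1 Lplus Lminus) ∧
            (∀ 𝔭 : PrimeSpectrum (IwasawaAlgebra 2), 𝔭.asIdeal.height = 1 →
              PowerSeries.C (2 : ℤ_[2]) ∉ 𝔭.asIdeal →
              Literature.NumberTheory.EllipticCurves.Module.lengthAt (IwasawaAlgebra 2) Y.X 𝔭 ≤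
                Literature.NumberTheory.EllipticCurves.Module.lengthAt (IwasawaAlgebra 2) (I.H ⧸ Z) 𝔭))
    (hT : SignedTransportAtTwo) :
    Summit.BirchSwinnertonDyer.WAllNonCMAtTwoThetaHabitat :=
  thetaHabitat_of_thetaPartnerItems hPub.1 hPub.2 hT
    (signedMainConjectureCMTwoRankZero_of_katoUpTo_of_mu hBF
      (WeierstrassCurve.hasEntireLFunction_rat_of_exists_isNewformOf
        (exists_isNewformOf_of_nonempty_modularParametrizationData hPub.1))
      hPub.2 h2 hT2A hmuA hKimA (katoUpToCM_of_colemanKatoRatCM hKatoPub.1 hKatoPub.2 hCKA))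
    (signedKatoDivisibilityUpToAtTwo_of_colemanKatoRatAtTwo hKatoPub.1 hKatoPub.2 hCK)
    (signedControlAtTwo_of_signedEulerCharAtTwo hEC)

/-! ## §3 Per pair `(E, A)`: the shape a class display applies — binders AT the two curves only -/

/-- **BSD₂ of a habitat curve from its CM partner, every research binder read AT THE PAIR** (not class-wide): for
`W` (non-CM, `r_an = 0`, good supersingular at `2`, `a₂ = 0`), a CM curve `A` (`r_an = 0`, good supersingular at `2`,
`a₂ = 0`) and a Galois-equivariant `W[2] ≃ A[2]`: PUB `hmod`/`hGZK`, Kato PUB `h124`/`hX0`, Burungale–Flach `hBF`,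
the `p = 2` period fact `h2`, TP2's K1 `hT` BY NAME; AT `W`: (2′) `hEC` and (4)ʳᵃᵗ `hCK`; AT `A`: (T2) `hT2A`, (μ)
`hmuA`, (K4c) `hKimA`, (4)ʳᵃᵗ `hCKA`. Proof = TP2's `closes` at the pair with K2r0-at-`A` from the companion file's
`kobayashiMainConjecture_two_one_conclusion_of_upperDivisibilityUpTo_of_mu_eq_zero` (BSD₂(A) := Burungale–Flach),
K3-at-`W` from §1, Kim's term at `W` from (2′) by H4 `exists_constantCoeff_eq_unit_mul_of_signedEulerChar`
(p526623), and the tree door `bsdp_two_of_kobayashiMainConjecture_two_of_frobeniusTrace_eq_zero`. No Eisenstein-side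
input on either curve. [cite: BurungaleFlach2024, Thm. 1.1 and Cor. 2] [cite: GreenbergVatsal2000, Thm. (1.4)]
[cite: Kobayashi2003, Thm. 1.2, Thm. 4.1, Conjecture (p. 2)] [cite: BDKim2013, Cor. 3.15] [cite: Miller2011LMS, Def. 1.1] -/
theorem bsdp_two_of_cmPartner_of_katoBothSides_at (hmod : nonempty_modularParametrizationData)
    (hGZK : rank_eq_analyticRank_of_analyticRank_le_one)
    (h124 : Kato2004.thm12_4) (hX0 : Kato2004_fineSelmerDual_isTorsion)
    (hBF : bsdTriple_of_hasCM_of_L_one_ne_zero) (h2 : realPeriodRat_eq_unit_mul_plusPeriod_two)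
    (hT : SignedTransportAtTwo)
    (W : WeierstrassCurve ℚ) [W.IsElliptic] [W.IsGloballyMinimal] (hcm : ¬ W.HasCM) (hr : W.analyticRank = 0)
    (hss : GoodSS W 2) (ha : W.frobeniusTrace 2 = 0)
    (A : WeierstrassCurve ℚ) [A.IsElliptic] [A.IsGloballyMinimal] (hAcm : A.HasCM) (hAr : A.analyticRank = 0)
    (hAss : GoodSS A 2) (hAa : A.frobeniusTrace 2 = 0)
    (e : WeierstrassCurve.geomTorsion W (2 : ℤ) ≃+ WeierstrassCurve.geomTorsion A (2 : ℤ))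
    (he : ∀ (σ : Field.absoluteGaloisGroup ℚ) (P : WeierstrassCurve.geomTorsion W (2 : ℤ)), e (σ • P) = σ • e P)
    (hEC : ∀ (κ : ZpExtension ℚ 2) (γ : Field.absoluteGaloisGroup ℚ),
          κ.IsCyclotomic → κ.IsTopGenerator γ → Finite (W.selmerGroupPInfty 2) →
          Finite (endInvariants (conjSignedSelmerInfty W κ 1 γ - 1)) ∧
            ∃ u : ℤ_[2]ˣ, (Nat.card (endInvariants (conjSignedSelmerInfty W κ 1 γ - 1)) : ℚ_[2]) =
              ((u : ℤ_[2]) : ℚ_[2]) * ((2 : ℕ) : ℚ_[2]) ^ (padicValNat 2 W.tamagawaProduct) *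
                (Nat.card (W.selmerGroupPInfty 2) : ℚ_[2]) *
                  (Nat.card (EndCoinvariants (conjSignedSelmerInfty W κ 1 γ - 1)) : ℚ_[2]))
    (hCK : ∀ (κ : ZpExtension ℚ 2) (γ : Field.absoluteGaloisGroup ℚ),
        κ.IsCyclotomic → κ.IsTopGenerator γ → IsCyclotomicVariable 2 γ →
        ∀ [NeZero (W.conductorNorm ℤ)] (f : CuspForm (Gamma0 (W.conductorNorm ℤ)) 2),
          IsNewformOf W f → ∀ (ϖ : ℚ), (ϖ : ℝ) * W.realPeriodRat = plusPeriod f →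
        ∀ (Lplus Lminus : IwasawaAlgebra 2), IsPollackPair f 2 Lplus Lminus →
        ∀ (D : SignedSelmerDualData W κ γ 1) [ContinuousSMul ℤ_[2] (W.tateModule 2)],
          ∃ (I : Kato2004.IwasawaH1Data W 2 κ γ) (Y : W.FineSelmerDualData κ γ)
            (P : Submodule (IwasawaAlgebra 2) (IwasawaAlgebra 2))
            (loc : I.H →ₗ[IwasawaAlgebra 2] P) (toX : P →ₗ[IwasawaAlgebra 2] D.X)
            (δ : D.X →ₗ[IwasawaAlgebra 2] Y.X) (Z : Submodule (IwasawaAlgebra 2) I.H)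
            (G : IwasawaAlgebra 2),
            Function.Exact loc toX ∧ Function.Exact toX δ ∧
            G ∈ Submodule.map (P.subtype ∘ₗ loc) Z ∧
            iwasawaToPowerSeries 2 G =
              PowerSeries.C (ϖ : ℚ_[2]) * iwasawaToPowerSeries 2 (kobayashiL 1 Lplus Lminus) ∧
            (∀ 𝔭 : PrimeSpectrum (IwasawaAlgebra 2), 𝔭.asIdeal.height = 1 →
              PowerSeries.C (2 : ℤ_[2]) ∉ 𝔭.asIdeal →
              Literature.NumberTheory.EllipticCurves.Module.lengthAt (IwasawaAlgebra 2) Y.X 𝔭 ≤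
                Literature.NumberTheory.EllipticCurves.Module.lengthAt (IwasawaAlgebra 2) (I.H ⧸ Z) 𝔭))
    (hT2A : ∀ (κ : ZpExtension ℚ 2) (γ : Field.absoluteGaloisGroup ℚ), κ.IsCyclotomic → κ.IsTopGenerator γ →
      ∀ D : SignedSelmerDualData A κ γ 1, Module.IsTorsion (IwasawaAlgebra 2) D.X)
    (hmuA : ∀ (κ : ZpExtension ℚ 2) (γ : Field.absoluteGaloisGroup ℚ), κ.IsCyclotomic → κ.IsTopGenerator γ →
      ∀ D : SignedSelmerDualData A κ γ 1, D.mu = 0)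
    (hKimA : ∀ (κ : ZpExtension ℚ 2) (γ : Field.absoluteGaloisGroup ℚ), κ.IsCyclotomic → κ.IsTopGenerator γ →
      ∀ (D : SignedSelmerDualData A κ γ 1) [Module.Finite (IwasawaAlgebra 2) D.X],
        Module.IsTorsion (IwasawaAlgebra 2) D.X →
      ∀ g : IwasawaAlgebra 2, D.charIdeal = Ideal.span {g} → Finite (A.selmerGroupPInfty 2) →
        ∃ u : ℤ_[2]ˣ, ((PowerSeries.constantCoeff g : ℤ_[2]) : ℚ_[2]) =
          ((u : ℤ_[2]) : ℚ_[2]) * ((2 : ℕ) : ℚ_[2]) ^ (padicValNat 2 A.tamagawaProduct) *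
            (Nat.card (A.selmerGroupPInfty 2) : ℚ_[2]))
    (hCKA : ∀ (κ : ZpExtension ℚ 2) (γ : Field.absoluteGaloisGroup ℚ),
        κ.IsCyclotomic → κ.IsTopGenerator γ → IsCyclotomicVariable 2 γ →
        ∀ [NeZero (A.conductorNorm ℤ)] (f : CuspForm (Gamma0 (A.conductorNorm ℤ)) 2),
          IsNewformOf A f → ∀ (ϖ : ℚ), (ϖ : ℝ) * A.realPeriodRat = plusPeriod f →
        ∀ (Lplus Lminus : IwasawaAlgebra 2), IsPollackPair f 2 Lplus Lminus →
        ∀ (D : SignedSelmerDualData A κ γ 1) [ContinuousSMul ℤ_[2] (A.tateModule 2)],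
          ∃ (I : Kato2004.IwasawaH1Data A 2 κ γ) (Y : A.FineSelmerDualData κ γ)
            (P : Submodule (IwasawaAlgebra 2) (IwasawaAlgebra 2))
            (loc : I.H →ₗ[IwasawaAlgebra 2] P) (toX : P →ₗ[IwasawaAlgebra 2] D.X)
            (δ : D.X →ₗ[IwasawaAlgebra 2] Y.X) (Z : Submodule (IwasawaAlgebra 2) I.H)
            (G : IwasawaAlgebra 2),
            Function.Exact loc toX ∧ Function.Exact toX δ ∧
            G ∈ Submodule.map (P.subtype ∘ₗ loc) Z ∧
            iwasawaToPowerSeries 2 G =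
              PowerSeries.C (ϖ : ℚ_[2]) * iwasawaToPowerSeries 2 (kobayashiL 1 Lplus Lminus) ∧
            (∀ 𝔭 : PrimeSpectrum (IwasawaAlgebra 2), 𝔭.asIdeal.height = 1 →
              PowerSeries.C (2 : ℤ_[2]) ∉ 𝔭.asIdeal →
              Literature.NumberTheory.EllipticCurves.Module.lengthAt (IwasawaAlgebra 2) Y.X 𝔭 ≤
                Literature.NumberTheory.EllipticCurves.Module.lengthAt (IwasawaAlgebra 2) (I.H ⧸ Z) 𝔭)) :
    BSDp W 2 := by
  have hLrat : hasEntireLFunction_rat := WeierstrassCurve.hasEntireLFunction_rat_of_exists_isNewformOf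
    (exists_isNewformOf_of_nonempty_modularParametrizationData hmod)
  have hL : W.entireLFunction 1 ≠ 0 := (W.analyticRank_eq_zero_iff_holds (hLrat W)).mp hr
  have hLA : A.entireLFunction 1 ≠ 0 := (A.analyticRank_eq_zero_iff_holds (hLrat A)).mp hAr
  have hBSDA : BSDp A 2 :=
    forall_bsdp_of_bsdTriple A A.tamagawaProduct_pos_holds (hBF A hAcm hLA) 2 Nat.prime_two
  -- the partner's analytic data (modularity, `L(A,1) ≠ 0`)
  haveI : NeZero (A.conductorNorm ℤ) := ⟨(A.conductorNorm_pos_holds).ne'⟩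
  obtain ⟨DmA⟩ := hmod A
  obtain ⟨ϖA, -, hϖAeq, -⟩ := DmA.exists_rat_mul_realPeriodRat_eq_plusPeriod
  obtain ⟨LsA, LfA, -, hPPA⟩ := exists_isPollackPair_two DmA.isNewformOf hAss.1 hAa hLA
  -- K2r0 AT `A`: torsion ∧ `μ⁺ = 0`, and the `+` main conjecture from the `2^m`-Kato half
  have hmuA' : ∀ (κ : ZpExtension ℚ 2) (γ : Field.absoluteGaloisGroup ℚ), κ.IsCyclotomic → κ.IsTopGenerator γ →
      ∀ D : SignedSelmerDualData A κ γ 1, Module.IsTorsion (IwasawaAlgebra 2) D.X ∧ D.mu = 0 :=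
    fun κ γ hκ hγ D => ⟨hT2A κ γ hκ hγ D, hmuA κ γ hκ hγ D⟩
  have hupA := katoUpTo_at_of_colemanKatoRat_at h124 hX0 A hCKA
  have hMCA : KobayashiMainConjecture A 2 1 := by
    intro κ γ hκ hγ hγ' _ f hf ϖ hϖ Lplus Lminus hPP D
    haveI := Kobayashi2003.SignedSelmerDualData.moduleFinite hγ D
    have hTors := hT2A κ γ hκ hγ D
    obtain ⟨g, h, m, hchar, hdiv⟩ := hupA κ γ hκ hγ hγ' f hf ϖ hϖ Lplus Lminus hPP D
    exact ⟨hTors, kobayashiMainConjecture_two_one_conclusion_of_upperDivisibilityUpTo_of_mu_eq_zero A hGZK hAss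
      hAa hLA hBSDA hKimA hκ hγ D hTors (hmuA κ γ hκ hγ D) hf hϖ
      (padicValRat_periodRatio_eq_zero_two A h2 hAss hf hϖ) hPP hchar hdiv⟩
  -- K1 at the pair, fed with K3 AT `W`
  have hMC : KobayashiMainConjecture W 2 1 :=
    hT W A hcm hr hss ha hAcm hAss hAa ⟨e, he⟩ DmA.f DmA.isNewformOf ϖA hϖAeq LsA LfA hPPA hmuA' hMCA
      (katoUpTo_at_of_colemanKatoRat_at h124 hX0 W hCK)
  -- K4 AT `W` from (2′) by H4
  have h12 : ∀ (κ : ZpExtension ℚ 2) (γ : Field.absoluteGaloisGroup ℚ), κ.IsCyclotomic → κ.IsTopGenerator γ →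
      ∀ D : SignedSelmerDualData W κ γ 1, Module.Finite (IwasawaAlgebra 2) D.X :=
    fun κ γ _ hγ D => Kobayashi2003.SignedSelmerDualData.moduleFinite hγ D
  have hKim : ∀ (κ : ZpExtension ℚ 2) (γ : Field.absoluteGaloisGroup ℚ), κ.IsCyclotomic → κ.IsTopGenerator γ →
      ∀ (D : SignedSelmerDualData W κ γ 1) [Module.Finite (IwasawaAlgebra 2) D.X],
        Module.IsTorsion (IwasawaAlgebra 2) D.X →
      ∀ g : IwasawaAlgebra 2, D.charIdeal = Ideal.span {g} → Finite (W.selmerGroupPInfty 2) →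
        ∃ u : ℤ_[2]ˣ, ((PowerSeries.constantCoeff g : ℤ_[2]) : ℚ_[2]) =
          ((u : ℤ_[2]) : ℚ_[2]) * ((2 : ℕ) : ℚ_[2]) ^ (padicValNat 2 W.tamagawaProduct) *
            (Nat.card (W.selmerGroupPInfty 2) : ℚ_[2]) := by
    intro κ γ hκ hγ D _ _ g hg hSel
    obtain ⟨hfin, u, hu⟩ := hEC κ γ hκ hγ hSel
    obtain ⟨u', hu'⟩ := exists_constantCoeff_eq_unit_mul_of_signedEulerChar W hγ D hg hfin
      (c := ((2 : ℕ) : ℚ_[2]) ^ (padicValNat 2 W.tamagawaProduct) * (Nat.card (W.selmerGroupPInfty 2) : ℚ_[2]))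
      ⟨u, by rw [hu]; ring⟩
    exact ⟨u', by rw [hu']; ring⟩
  exact bsdp_two_of_kobayashiMainConjecture_two_of_frobeniusTrace_eq_zero W hmod hGZK hss.1 ha hL h12 hKim hMC

end ThetaPartnerXRoute

end Summit.BirchSwinnertonDyer.BirchSwinnertonDyer.Theorems

end
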